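import Mathlib
import HarnessLib.Audit.Tags
import Summits.Ventures.ResidMod.Conjectures.ImprimitiveCertificates

/-!
# Sharp order bound for two-element blocks: `|Gal| ∣ 48` (TODO-29 remainder (a); bus R306)

Honest framing: elementary Galois theory of integer sextics, PROVED; no curve, no Galois-image determination, no
modularity claim, no new census.  This file sharpens one bound of `ImprimitiveCertificates.lean` (p369982): there
`M23_twoBlocks_card_dvd` gives the hypothesis-free `|Gal(f/ℚ)| ∣ 144` for a `HasTwoBlocks` certificate (a quadratic
factor over a cubic field `ℚ[Y]/(S)`); here, for an IRREDUCIBLE sextic, the sharp `|Gal(f/ℚ)| ∣ 48 = |C₂ ≀ S₃|`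
(`M23_twoBlocks_card_dvd_48`).  Irreducibility cannot be dropped for `48`: a product of two unrelated `S₃`-cubics
carries a `HasTwoBlocks` certificate and has `|Gal| = 36 ∤ 48` (recorded, not typed).  The registration of the exact
statements BEFORE proof is bus ruling R306 (cell «pub-residmod», 2026-08-23); nothing numerical is claimed.

Mechanism (blocks, not towers).  In a finite Galois `E/ℚ` where `F` and `S` split, a root `a` of the quadratic factor
has `[ℚ⟮a⟯:ℚ] = 6` while `[K⟮a⟯:ℚ] = 3·deg(minpoly_K a) ≤ 6` for the cubic field `K = ℚ⟮y⟯`, so `K ≤ ℚ⟮a⟯` and the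
stabiliser of `a` in `Gal(F)` lies in the image `H` of `Gal(E/K)`; Mathlib's `MulAction.IsBlock.of_orbit` makes
`H • a` a block of the faithful transitive action on the six roots, of size exactly `2` (`⊆ roots` of the quadratic
factor; `a ∉ K = Fix Gal(E/K)`), hence with three translates, and the folklore divisibility bound
`card_dvd_pow_factorial_mul_factorial_of_translates` (`|G| ∣ (|B|!)^b · b!`, proved here; the tree's
`Literature.GroupTheory.PermutationGroups.card_le_pow_factorial_mul_factorial_of_translates` is the `≤` form, which
together with `∣ 144` would not exclude `36` or `18`) gives `∣ 2!³·3! = 48`.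

Main results (all PROVED, axioms `propext`, `Classical.choice`, `Quot.sound` only):
* `card_dvd_pow_factorial_mul_factorial_of_translates` — faithful transitive `G ↷ X`, `∅ ≠ B ⊆ X` with `b`
  translates: `|G| ∣ (|B|!)^b · b!`;
* `card_gal_dvd_48_of_quadratic_factor`, `card_gal_dvd_48_of_twoBlocks_data` — the Galois-theoretic core over an
  arbitrary finite Galois `E/ℚ`;
* `M23_twoBlocks_card_dvd_48` — `NonDegenerate f → Irreducible (toRatPoly f) → HasTwoBlocks f → |Gal| ∣ 48`;
* `M23_irreducible_card_dvd_72_or_48` — bookkeeping with `M23_threeBlocks_card_dvd` (`∣ 72`, p369982): an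
  irreducible certified member has `|Gal| ∣ 72 ∨ |Gal| ∣ 48` (both refine the `∣ 144` behind `M23_not_typical`).
Technical note: over the base field `ℚ` instance search picks `DivisionRing.toRatAlgebra` for
`Algebra ℚ (SplittingField _)`, which agrees with the splitting field's own structure definitionally but not
reducibly; the final theorem therefore ascribes the type of `SplittingField.splits` and names
`SplittingField.instNormal` instead of relying on instance search (see the comment in the proof).
-/

open Polynomial Module

namespace Summit.Ventures.ResidMod.Conjectures

section PermGroup

open Equiv Equiv.Perm MulAction Subgroup
open scoped Pointwise

/-- **Order of a faithful transitive action with a system of translates (divisibility form).**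
If `G` acts faithfully and transitively on a finite type `X` and `B ⊆ X` is non-empty with `b` translates
`g • B`, then `|G| ∣ (|B|!)^b · b!`: `G` permutes the translates (image of order dividing `b!`), and the kernel
of that action embeds as a subgroup of `∏_C Sym(C)` because the translates cover `X`.  (The tree's
`Literature.GroupTheory.PermutationGroups.card_le_pow_factorial_mul_factorial_of_translates` is the `≤` form
for subgroups of `Sym(X)`; the divisibility form is what turns `|B| = 2`, `b = 3` into `∣ 48`.) [folklore] -/
theorem card_dvd_pow_factorial_mul_factorial_of_translates {G X : Type*} [Group G] [MulAction G X]
    [Fintype X] (hfaith : Function.Injective (MulAction.toPermHom G X)) [IsPretransitive G X]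
    (B : Set X) (hB : B.Nonempty) :
    Nat.card G ∣ (B.ncard).factorial ^ (orbit G B).ncard * ((orbit G B).ncard).factorial := by
  classical
  -- the action on the translates
  let φ : G →* Perm (orbit G B) := MulAction.toPermHom G (orbit G B)
  -- the kernel fixes every translate (as a set)
  have hker : ∀ k ∈ φ.ker, ∀ C : orbit G B, k • (C : Set X) = C := by
    intro k hk C
    have hk1 : φ k = 1 := hk
    have hC : k • C = C := by
      have := Equiv.Perm.ext_iff.mp hk1 C
      simpa [φ] using this
    have := congrArg Subtype.val hC
    simpa using this
  -- the translates cover `X`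
  have hcover : ∀ x : X, ∃ C : orbit G B, x ∈ (C : Set X) := by
    intro x
    obtain ⟨y, hy⟩ := hB
    obtain ⟨g, hg⟩ := exists_smul_eq G y x
    refine ⟨⟨g • B, mem_orbit B g⟩, ?_⟩
    rw [← hg]
    exact Set.smul_mem_smul_set hy
  -- so the kernel embeds in `∏_C Sym(C)`
  have hiff : ∀ k : φ.ker, ∀ C : orbit G B, ∀ x : X,
      (k : G) • x ∈ (C : Set X) ↔ x ∈ (C : Set X) := by
    intro k C x
    conv_lhs => rw [← hker k k.2 C]
    exact Set.smul_mem_smul_set_iff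
  let Ψ : φ.ker →* (∀ C : orbit G B, Perm {x // x ∈ (C : Set X)}) :=
    { toFun := fun k C => (@MulAction.toPerm G X _ _ (k : G)).subtypePerm
        (fun x => by rw [MulAction.toPerm_apply]; exact hiff k C x)
      map_one' := by
        ext C x
        simp
      map_mul' := by
        intro k k'
        ext C x
        simp [mul_smul] }
  have hΨ : Function.Injective Ψ := by
    intro k k' h
    apply Subtype.ext
    apply hfaith
    ext x
    obtain ⟨C, hC⟩ := hcover x
    have h1 : Ψ k C ⟨x, hC⟩ = Ψ k' C ⟨x, hC⟩ := by rw [h]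
    simpa [Ψ] using congrArg Subtype.val h1
  have hK : Nat.card φ.ker ∣ (B.ncard).factorial ^ (orbit G B).ncard := by
    have h := Subgroup.card_dvd_of_injective Ψ hΨ
    rw [Nat.card_pi] at h
    have hC : ∀ C : orbit G B, Nat.card (Perm {x // x ∈ (C : Set X)}) = (B.ncard).factorial := by
      intro C
      obtain ⟨g, hg⟩ := mem_orbit_iff.mp C.2
      rw [Nat.card_perm, Nat.card_coe_set_eq, ← hg, Set.ncard_smul_set]
    simp only [hC, Finset.prod_const, Finset.card_univ] at h
    rwa [← Nat.card_eq_fintype_card, Nat.card_coe_set_eq] at h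
  have hrange : φ.ker.index ∣ ((orbit G B).ncard).factorial := by
    rw [index_ker, ← Nat.card_coe_set_eq, ← Nat.card_perm]
    exact card_subgroup_dvd_card φ.range
  calc Nat.card G = Nat.card φ.ker * φ.ker.index := (card_mul_index φ.ker).symm
    _ ∣ (B.ncard).factorial ^ (orbit G B).ncard * ((orbit G B).ncard).factorial :=
        mul_dvd_mul hK hrange

end PermGroup

section Galois

open MulAction IntermediateField
open scoped Pointwise

/-- **Core of the sharp bound.**  Let `E/ℚ` be finite Galois, `F ∈ ℚ[X]` irreducible separable of degree `6`
splitting in `E`, and `K ≤ E` a cubic subfield over which `F` has a quadratic factor `qK`.  Then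
`|Gal(F/ℚ)| ∣ 48 = |C₂ ≀ S₃|`.  Proof: a root `a ∈ E` of `qK` has `[ℚ⟮a⟯:ℚ] = 6` (irreducibility) while
`[K⟮a⟯:ℚ] = 3·deg(minpoly_K a) ≤ 6`, so `K ≤ ℚ⟮a⟯`; hence `Stab(a) ≤ H :=` image of `Gal(E/K)` in `Gal(F)`,
and `B := H·a` is a block (Mathlib `IsBlock.of_orbit`) of the faithful transitive action on the six roots;
`B ⊆ roots(qK)` gives `|B| ≤ 2`, `a ∉ K = Fix(Gal(E/K))` gives `|B| ≥ 2`; three translates;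
`card_dvd_pow_factorial_mul_factorial_of_translates`. [folklore; elementary Galois theory] -/
theorem card_gal_dvd_48_of_quadratic_factor {E : Type*} [Field E] [Algebra ℚ E] [FiniteDimensional ℚ E]
    [IsGalois ℚ E] {F : ℚ[X]} (hirr : Irreducible F) (hsep : F.Separable) (hF6 : F.natDegree = 6)
    [Fact ((F.map (algebraMap ℚ E)).Splits)] (K : IntermediateField ℚ E) (hK3 : finrank ℚ K = 3)
    {qK rK : K[X]} (hqK2 : qK.natDegree = 2) (hqrK : F.map (algebraMap ℚ K) = qK * rK) :
    Nat.card F.Gal ∣ 48 := by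
  classical
  have hsplitF : (F.map (algebraMap ℚ E)).Splits := Fact.out
  have hF0 : F ≠ 0 := hirr.ne_zero
  have hFE0 : F.map (algebraMap ℚ E) ≠ 0 :=
    (Polynomial.map_ne_zero_iff (algebraMap ℚ E).injective).mpr hF0
  have hqK0 : qK ≠ 0 := by
    intro h
    rw [h, natDegree_zero] at hqK2
    exact absurd hqK2 (by norm_num)
  -- the quadratic factor in `E[X]`
  let qE : E[X] := qK.map (algebraMap K E)
  have hqrE : F.map (algebraMap ℚ E) = qE * rK.map (algebraMap K E) := by
    rw [IsScalarTower.algebraMap_eq ℚ K E, ← Polynomial.map_map, hqrK, Polynomial.map_mul]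
  have hqE2 : qE.natDegree = 2 := by
    rw [natDegree_map_eq_of_injective (algebraMap K E).injective, hqK2]
  have hqE0 : qE ≠ 0 := by
    intro h
    rw [h, natDegree_zero] at hqE2
    exact absurd hqE2 (by norm_num)
  -- a root `a` of `qE`: a root of `F`, of degree `6` over `ℚ`
  have hqEsplits : qE.Splits := hsplitF.of_dvd hFE0 (Dvd.intro _ hqrE.symm)
  obtain ⟨a, ha⟩ := hqEsplits.exists_eval_eq_zero
    (degree_ne_of_natDegree_ne (by rw [hqE2]; norm_num))
  have hqKa : aeval a qK = 0 := by rwa [← eval_map_algebraMap]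
  have haF : aeval a F = 0 := by
    rw [← eval_map_algebraMap, hqrE, eval_mul, ha, zero_mul]
  have hamem : a ∈ F.rootSet E := mem_rootSet.mpr ⟨hF0, haF⟩
  have haint : IsIntegral ℚ a := .of_finite ℚ a
  have hQa6 : finrank ℚ ℚ⟮a⟯ = 6 := by
    rw [adjoin.finrank haint, ← minpoly.eq_of_irreducible hirr haF,
      natDegree_mul_C (inv_ne_zero (leadingCoeff_ne_zero.mpr hF0)), hF6]
  -- `K ≤ ℚ⟮a⟯` (this is where irreducibility is used)
  have hKle : K ≤ ℚ⟮a⟯ := by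
    have haK : IsIntegral K a := haint.tower_top
    have hdeg : (minpoly K a).natDegree ≤ 2 := by
      have := natDegree_le_of_dvd (minpoly.dvd K a hqKa) hqK0
      rwa [hqK2] at this
    have htower : finrank ℚ K * finrank K K⟮a⟯ = finrank ℚ K⟮a⟯ :=
      Module.finrank_mul_finrank ℚ K K⟮a⟯
    rw [adjoin.finrank haK, hK3] at htower
    have h1 : finrank ℚ ((K⟮a⟯).restrictScalars ℚ) ≤ finrank ℚ ℚ⟮a⟯ := by
      rw [hQa6]
      change finrank ℚ K⟮a⟯ ≤ 6
      rw [← htower]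
      omega
    have h2 : ℚ⟮a⟯ ≤ (K⟮a⟯).restrictScalars ℚ := by
      rw [adjoin_simple_le_iff, IntermediateField.mem_restrictScalars]
      exact mem_adjoin_simple_self K a
    have heq : ℚ⟮a⟯ = (K⟮a⟯).restrictScalars ℚ := IntermediateField.eq_of_le_of_finrank_le h2 h1
    intro x hx
    rw [heq, IntermediateField.mem_restrictScalars]
    exact (K⟮a⟯).algebraMap_mem ⟨x, hx⟩
  -- `Gal(F)` acting on the six roots of `F` in `E`; `H` = image of `Gal(E/K)` under restriction
  haveI : IsPretransitive F.Gal (F.rootSet E) := Gal.galAction_isPretransitive F E hirr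
  set H : Subgroup F.Gal := (K.fixingSubgroup).map (Gal.restrict F E) with hH
  have hmemH : ∀ σ : Gal(E/ℚ), σ ∈ K.fixingSubgroup → Gal.restrict F E σ ∈ H := by
    intro σ hσ
    rw [hH, Subgroup.mem_map]
    exact ⟨σ, hσ, rfl⟩
  let a' : F.rootSet E := ⟨a, hamem⟩
  -- `Stab(a) ≤ H`
  have hstab : stabilizer F.Gal a' ≤ H := by
    intro g hg
    rw [mem_stabilizer_iff] at hg
    obtain ⟨σ, rfl⟩ := Gal.restrict_surjective F E g
    have hσa : σ a = a := by
      have := congrArg Subtype.val hg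
      rwa [Gal.restrict_smul] at this
    refine hmemH σ ?_
    rw [IntermediateField.mem_fixingSubgroup_iff]
    intro x hx
    have hfix : ∀ z ∈ ℚ⟮a⟯, σ • z = z :=
      (forall_mem_adjoin_smul_eq_self_iff ℚ σ).mpr (by simpa [AlgEquiv.smul_def] using hσa)
    simpa only [AlgEquiv.smul_def] using hfix x (hKle hx)
  -- the block `B = H • a`
  let B : Set (F.rootSet E) := orbit H a'
  have hBblock : IsBlock F.Gal B := IsBlock.of_orbit hstab
  have hBne : B.Nonempty := ⟨a', mem_orbit_self a'⟩
  -- `Gal(E/K)` maps `a` to roots of `qE`, so `B ⊆ roots(qE)`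
  have hrootσ : ∀ σ : Gal(E/ℚ), σ ∈ K.fixingSubgroup → eval (σ a) qE = 0 := by
    intro σ hσ
    have hσ' : ∀ z, (fixingSubgroupEquiv K ⟨σ, hσ⟩) z = σ z := fun z => rfl
    rw [← hσ' a, eval_map_algebraMap, aeval_algHom_apply, hqKa, map_zero]
  have hBsub : ∀ b ∈ B, eval ((b : F.rootSet E) : E) qE = 0 := by
    intro b hb
    obtain ⟨h, rfl⟩ := mem_orbit_iff.mp hb
    have h2 : (h : F.Gal) ∈ (K.fixingSubgroup).map (Gal.restrict F E) := by
      rw [← hH]; exact h.2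
    obtain ⟨σ, hσ, hh⟩ := Subgroup.mem_map.mp h2
    rw [Subgroup.smul_def, ← hh, Gal.restrict_smul]
    exact hrootσ σ hσ
  -- `|B| ≤ 2`
  have hBle : B.ncard ≤ 2 := by
    have hsub : Subtype.val '' B ⊆ (qE.roots.toFinset : Set E) := by
      rintro _ ⟨b, hb, rfl⟩
      rw [Finset.mem_coe, Multiset.mem_toFinset, mem_roots hqE0, IsRoot.def]
      exact hBsub b hb
    calc B.ncard = (Subtype.val '' B).ncard :=
          (Set.ncard_image_of_injective B Subtype.val_injective).symm
      _ ≤ (qE.roots.toFinset : Set E).ncard := Set.ncard_le_ncard hsub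
      _ = qE.roots.toFinset.card := Set.ncard_coe_finset _
      _ ≤ Multiset.card qE.roots := Multiset.toFinset_card_le _
      _ ≤ qE.natDegree := card_roots' qE
      _ = 2 := hqE2
  -- `|B| ≥ 2`: some `σ ∈ Gal(E/K)` moves `a`, for otherwise `a ∈ Fix(Gal(E/K)) = K` and `6 ≤ 3`
  have hBge : 2 ≤ B.ncard := by
    by_cases hall : ∀ σ ∈ K.fixingSubgroup, σ a = a
    · exfalso
      have haK : a ∈ K := by
        rw [← IsGalois.fixedField_fixingSubgroup K, IntermediateField.mem_fixedField_iff]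
        exact hall
      have hle : ℚ⟮a⟯ ≤ K := adjoin_simple_le_iff.mpr haK
      have := IntermediateField.finrank_le_of_le_right hle
      rw [hQa6, hK3] at this
      omega
    · push Not at hall
      obtain ⟨σ, hσ, hσa⟩ := hall
      have hne : ((⟨Gal.restrict F E σ, hmemH σ hσ⟩ : H) • a' : F.rootSet E) ≠ a' := by
        intro h
        have := congrArg Subtype.val h
        rw [Subgroup.mk_smul, Gal.restrict_smul] at this
        exact hσa this
      have h1 : 1 < B.ncard :=
        (Set.one_lt_ncard (Set.toFinite B)).mpr ⟨_, mem_orbit a' _, a', mem_orbit_self a', hne⟩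
      omega
  have hB2 : B.ncard = 2 := le_antisymm hBle hBge
  -- six roots, hence three translates
  have hX6 : Nat.card (F.rootSet E) = 6 := by
    rw [Nat.card_eq_fintype_card, card_rootSet_eq_natDegree hsep hsplitF, hF6]
  have hkey := hBblock.ncard_block_mul_ncard_orbit_eq hBne
  rw [hB2, hX6] at hkey
  have horb : (orbit F.Gal B).ncard = 3 := by omega
  -- the folklore bound `|Gal(F)| ∣ (2!)³ · 3! = 48`
  have h := card_dvd_pow_factorial_mul_factorial_of_translates (G := F.Gal) (X := F.rootSet E)
    (Gal.galActionHom_injective F E) B hBne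
  have h48 : (Nat.factorial 2) ^ 3 * Nat.factorial 3 = 48 := by decide
  rw [hB2, horb, h48] at h
  exact h

/-- **From the data of a `HasTwoBlocks` certificate.**  If `E/ℚ` is finite Galois and both the irreducible
separable sextic `F` and the irreducible cubic `S` split in `E`, and `F` has a quadratic factor over `ℚ[Y]/(S)`,
then `|Gal(F/ℚ)| ∣ 48`: pick a root `y ∈ E` of `S`, transport the factorisation along `ℚ[Y]/(S) → K := ℚ⟮y⟯`,
`Y ↦ y`, and apply `card_gal_dvd_48_of_quadratic_factor`. [folklore] -/
theorem card_gal_dvd_48_of_twoBlocks_data {E : Type*} [Field E] [Algebra ℚ E] [FiniteDimensional ℚ E]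
    [IsGalois ℚ E] {F S : ℚ[X]} (hirr : Irreducible F) (hsep : F.Separable) (hF6 : F.natDegree = 6)
    (hS3 : S.natDegree = 3) (hSirr : Irreducible S) {q r : (AdjoinRoot S)[X]} (hq2 : q.natDegree = 2)
    (hqr : F.map (algebraMap ℚ (AdjoinRoot S)) = q * r)
    (hsplitF : (F.map (algebraMap ℚ E)).Splits) (hsplitS : (S.map (algebraMap ℚ E)).Splits) :
    Nat.card F.Gal ∣ 48 := by
  classical
  haveI : Fact ((F.map (algebraMap ℚ E)).Splits) := ⟨hsplitF⟩
  have hS0 : S ≠ 0 := hSirr.ne_zero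
  -- a root `y` of `S` in `E`; the cubic field `K = ℚ⟮y⟯`
  have hSE3 : (S.map (algebraMap ℚ E)).natDegree = 3 := by
    rw [natDegree_map_eq_of_injective (algebraMap ℚ E).injective, hS3]
  obtain ⟨y, hy⟩ := hsplitS.exists_eval_eq_zero
    (degree_ne_of_natDegree_ne (by rw [hSE3]; norm_num))
  have hyS : aeval y S = 0 := by rwa [← eval_map_algebraMap]
  have hyint : IsIntegral ℚ y := .of_finite ℚ y
  set K : IntermediateField ℚ E := ℚ⟮y⟯ with hKdef
  have hK3 : finrank ℚ K = 3 := by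
    rw [hKdef, adjoin.finrank hyint, ← minpoly.eq_of_irreducible hSirr hyS,
      natDegree_mul_C (inv_ne_zero (leadingCoeff_ne_zero.mpr hS0)), hS3]
  -- transport the factorisation along `ψ : ℚ[Y]/(S) → K`, `Y ↦ y`
  let yK : K := ⟨y, mem_adjoin_simple_self ℚ y⟩
  have hyK : aeval yK S = 0 :=
    (aeval_algebraMap_eq_zero_iff_of_injective (x := yK) (p := S) (algebraMap K E).injective).mp hyS
  let ψ : AdjoinRoot S →+* K := AdjoinRoot.lift (algebraMap ℚ K) yK (by rwa [aeval_def] at hyK)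
  have hψ : ψ.comp (algebraMap ℚ (AdjoinRoot S)) = algebraMap ℚ K := Subsingleton.elim _ _
  have hqrK : F.map (algebraMap ℚ K) = q.map ψ * r.map ψ := by
    rw [← hψ, ← Polynomial.map_map, hqr, Polynomial.map_mul]
  -- only now make `ℚ[Y]/(S)` a field (the instance changes the elaboration of `algebraMap ℚ (AdjoinRoot S)`)
  haveI : Fact (Irreducible S) := ⟨hSirr⟩
  have hqK2 : (q.map ψ).natDegree = 2 := by
    rw [natDegree_map_eq_of_injective ψ.injective, hq2]
  exact card_gal_dvd_48_of_quadratic_factor hirr hsep hF6 K hK3 hqK2 hqrK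

/-- PROVED (TODO-29 remainder (a), bus R306; SHARP form of `M23_twoBlocks_card_dvd`, p369982): an IRREDUCIBLE
non-degenerate sextic with a `HasTwoBlocks` certificate has `|Gal(f/ℚ)| ∣ 48 = |C₂ ≀ S₃|`.  Irreducibility is
necessary for `48` (a product of two unrelated `S₃`-cubics carries a `HasTwoBlocks` certificate and has
`|Gal| = 36 ∤ 48`); the hypothesis-free bound is the `∣ 144` of `M23_twoBlocks_card_dvd` (p369982).  The ambient
Galois field is the splitting field of `F · S`. -/
theorem M23_twoBlocks_card_dvd_48 :
    ∀ f : Sextic, NonDegenerate f → Irreducible (toRatPoly f) → HasTwoBlocks f →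
      Nat.card (toRatPoly f).Gal ∣ 48 := by
  intro f hnd hirr h2
  obtain ⟨S, hS3, hSirr, q, r, hq2, hqr⟩ := h2
  have hF6 : (toRatPoly f).natDegree = 6 := natDegree_toRatPoly hnd.1
  have hFS0 : toRatPoly f * S ≠ 0 := mul_ne_zero hirr.ne_zero hSirr.ne_zero
  -- Over the base field `ℚ` instance search picks `DivisionRing.toRatAlgebra` for `Algebra ℚ (SplittingField _)`,
  -- which agrees with the splitting field's own `ℚ`-algebra structure definitionally but not reducibly: so the
  -- type of `hsplit` is ascribed (elaborated here) and `Normal` is supplied by name rather than found by search.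
  have hsplit : ((toRatPoly f * S).map (algebraMap ℚ (toRatPoly f * S).SplittingField)).Splits :=
    SplittingField.splits (toRatPoly f * S)
  have hne : (toRatPoly f * S).map (algebraMap ℚ (toRatPoly f * S).SplittingField) ≠ 0 :=
    (Polynomial.map_ne_zero_iff (algebraMap ℚ _).injective).mpr hFS0
  haveI : IsGalois ℚ (toRatPoly f * S).SplittingField :=
    IsGalois.mk (to_normal := SplittingField.instNormal (toRatPoly f * S))
  exact card_gal_dvd_48_of_twoBlocks_data hirr hnd.2 hF6 hS3 hSirr hq2 hqr
    (hsplit.of_dvd hne (Polynomial.map_dvd _ (dvd_mul_right _ _)))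
    (hsplit.of_dvd hne (Polynomial.map_dvd _ (dvd_mul_left _ _)))

/-- PROVED bookkeeping (R306 (3)): an IRREDUCIBLE non-degenerate member certified imprimitive either way has
`|Gal| ∣ 72` (blocks of size `3`, `M23_threeBlocks_card_dvd`, p369982) or `|Gal| ∣ 48` (blocks of size `2`, sharp,
`M23_twoBlocks_card_dvd_48`).  Both alternatives refine the `∣ 144` used by `M23_not_typical` / `M23_orderOf_ne_five`;
which one holds is decided by the certificate, not claimed here. -/
theorem M23_irreducible_card_dvd_72_or_48 {f : Sextic} (hnd : NonDegenerate f) (hirr : Irreducible (toRatPoly f))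
    (hcert : HasThreeBlocks f ∨ HasTwoBlocks f) :
    Nat.card (toRatPoly f).Gal ∣ 72 ∨ Nat.card (toRatPoly f).Gal ∣ 48 :=
  hcert.imp (M23_threeBlocks_card_dvd f hnd) (M23_twoBlocks_card_dvd_48 f hnd hirr)

end Galois

end Summit.Ventures.ResidMod.Conjectures
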